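import Mathlib
import Summits.KontsevichZagierPeriods.Statement
import Summits.KontsevichZagierPeriods.KontsevichZagierPeriods.Theses.Grothendieck

/-!
# Sketch — crux-ideate stmt-KontsevichZagierPeriods-0275 (ideator 1): first lemmas of the lines

Card `product-cell-squeeze`: the weight-4 double shuffle entirely on the product cell
`P = Δ₂ × Δ₂ ⊂ ℝ⁴` and the simplex `Δ₄`, with the squeeze maps
`Ψ(t) = (t₀, t₁, t₁t₂, t₁t₃)`, `Ψ'(t) = (t₂, t₃, t₃t₀, t₃t₁)` (stuffle, 5 moves) and the order-type
dissection (shuffle). Statements only (sorried): they must elaborate over existing declarations.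
-/

noncomputable section

open Set MeasureTheory
open Literature.NumberTheory.Transcendental

namespace Summit.KontsevichZagierPeriods.KontsevichZagierPeriods.Cruxes.GpcZeta4Eq4zeta31.SketchIdeator1

/-- The product cell `P = Δ₂ × Δ₂ ⊂ ℝ⁴` (first simplex in coordinates 0,1; second in 2,3). -/
def prodCell : Set (Fin 4 → ℝ) :=
  {t | 1 > t 0 ∧ t 0 > t 1 ∧ t 1 > 0 ∧ 1 > t 2 ∧ t 2 > t 3 ∧ t 3 > 0}

/-- The literal domain of the crux, `Δ₄ = {1 > t₀ > t₁ > t₂ > t₃ > 0}`. -/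
def simplex4 : Set (Fin 4 → ℝ) :=
  {t | 1 > t 0 ∧ t 0 > t 1 ∧ t 1 > t 2 ∧ t 2 > t 3 ∧ t 3 > 0}

/-- The squeeze map `Ψ(t) = (t₀, t₁, t₁t₂, t₁t₃)`: scale the second simplex under the last
coordinate of the first; a polynomial bijection `P → Δ₄` with Jacobian `t₁²`. -/
def squeeze (t : Fin 4 → ℝ) : Fin 4 → ℝ := ![t 0, t 1, t 1 * t 2, t 1 * t 3]

/-- Its block-swapped twin `Ψ'(t) = (t₂, t₃, t₃t₀, t₃t₁)`, Jacobian `t₃²`. -/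
def squeeze' (t : Fin 4 → ℝ) : Fin 4 → ℝ := ![t 2, t 3, t 3 * t 0, t 3 * t 1]

/-- The derivative of `squeeze` at `t`, as a continuous linear map (Jacobian matrix
`[[1,0,0,0],[0,1,0,0],[0,t₂,t₁,0],[0,t₃,0,t₁]]`). -/
def squeezeDeriv (t : Fin 4 → ℝ) : (Fin 4 → ℝ) →L[ℝ] (Fin 4 → ℝ) :=
  LinearMap.toContinuousLinearMap
    (Matrix.toLin' !![1, 0, 0, 0; 0, 1, 0, 0; 0, t 2, t 1, 0; 0, t 3, 0, t 1])

/-- **FIRST LEMMA of the line (the diagonal stuffle term is ONE move).** For any representation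
`q` on the product cell with integrand `1/(t₀ t₂ (1 − t₁t₃))` (the `m = n` term of `ζ(2)·ζ(2)` in
simplex coordinates) and any representation `z4` of `ζ(4)` as in the crux,
`[q] − [z4] ∈ changeOfVariablesRel` via `Ψ`: `ω₀₀₀₁(Ψ t) · t₁² = 1/(t₀ t₂ (1 − t₁ t₃))`. -/
theorem diagonal_term_is_one_move (q z4 : KZ.IntegralRep 4)
    (hq : q.domain = prodCell)
    (hqf : EqOn q.integrand (fun t => 1 / (t 0 * t 2 * (1 - t 1 * t 3))) q.domain)
    (h4 : z4.domain = simplex4)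
    (h4f : EqOn z4.integrand (fun t => 1 / (t 0 * t 1 * t 2 * (1 - t 3))) z4.domain) :
    KZ.of q - KZ.of z4 ∈ KZ.changeOfVariablesRel := by
  sorry

/-- **Stuffle on the product cell (5 moves).** `[P, ω₀₁⊗ω₀₁] − 2[Δ₄, ω₀₁₀₁] − [Δ₄, ω₀₀₀₁] ∈ relations`:
partial fractions `1/((1−t₁)(1−t₃)) = t₁/((1−t₁)(1−t₁t₃)) + t₃/((1−t₃)(1−t₁t₃)) + 1/(1−t₁t₃)`
(two integrand-additivity moves, all three pieces positive and dominated by the product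
integrand), then `Ψ`, `Ψ`, `Ψ'` (three change-of-variables moves). Note that the product integrand
on `P` and the `ζ(2,2)` integrand on `Δ₄` are the SAME rational function `1/(t₀(1−t₁)t₂(1−t₃))`. -/
theorem stuffle_on_prodCell (p z22 z4 : KZ.IntegralRep 4)
    (hp : p.domain = prodCell)
    (hpf : EqOn p.integrand (fun t => 1 / (t 0 * (1 - t 1) * t 2 * (1 - t 3))) p.domain)
    (h22 : z22.domain = simplex4)
    (h22f : EqOn z22.integrand (fun t => 1 / (t 0 * (1 - t 1) * t 2 * (1 - t 3))) z22.domain)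
    (h4 : z4.domain = simplex4)
    (h4f : EqOn z4.integrand (fun t => 1 / (t 0 * t 1 * t 2 * (1 - t 3))) z4.domain) :
    KZ.of p - 2 • KZ.of z22 - KZ.of z4 ∈ KZ.relations := by
  sorry

/-- **Shuffle on the product cell (dissection).** `[P, ω₀₁⊗ω₀₁] − 2[Δ₄, ω₀₁₀₁] − 4[Δ₄, ω₀₀₁₁] ∈
relations`: `P` minus the null tie-walls is the disjoint union of the six order cells
`0123 ↦ 0101, 0213 ↦ 0011, 0231 ↦ 0011, 2013 ↦ 0011, 2031 ↦ 0011, 2301 ↦ 0101`, each a coordinate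
permutation of `Δ₄` (moves (1a) + (2); a null-domain representation is itself a relation). -/
theorem shuffle_on_prodCell (p z22 z31 : KZ.IntegralRep 4)
    (hp : p.domain = prodCell)
    (hpf : EqOn p.integrand (fun t => 1 / (t 0 * (1 - t 1) * t 2 * (1 - t 3))) p.domain)
    (h22 : z22.domain = simplex4)
    (h22f : EqOn z22.integrand (fun t => 1 / (t 0 * (1 - t 1) * t 2 * (1 - t 3))) z22.domain)
    (h31 : z31.domain = simplex4)
    (h31f : EqOn z31.integrand (fun t => 1 / (t 0 * t 1 * (1 - t 2) * (1 - t 3))) z31.domain) :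
    KZ.of p - 2 • KZ.of z22 - 4 • KZ.of z31 ∈ KZ.relations := by
  sorry

/-- **Existence of the product-cell representation** (absolute convergence = Fubini on the product
of two absolutely convergent `ζ(2)` simplex integrals; e.g. the domain/integrand of
`(KZ.mzvRep [2]).prod (KZ.mzvRep [2])` rewritten, `KZProduct.lean`). -/
theorem exists_prodCell_rep :
    ∃ p : KZ.IntegralRep 4, p.domain = prodCell ∧
      EqOn p.integrand (fun t => 1 / (t 0 * (1 - t 1) * t 2 * (1 - t 3))) p.domain := by
  sorry

/-- **Composition** (bookkeeping: `4•[z31] ≡ [Δ₄, 4ω₀₀₁₁]` by three integrand-additivity moves and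
the `EqOn` packaging, both already proved in `Cruxes/StuffleInKZ/Disproof.lean §8`,
`Glue4.zeta4Calibration_of`). -/
theorem crux_of_productCell_doubleShuffle
    (hSt : ∀ p z22 z4 : KZ.IntegralRep 4, p.domain = prodCell →
      EqOn p.integrand (fun t => 1 / (t 0 * (1 - t 1) * t 2 * (1 - t 3))) p.domain →
      z22.domain = simplex4 →
      EqOn z22.integrand (fun t => 1 / (t 0 * (1 - t 1) * t 2 * (1 - t 3))) z22.domain →
      z4.domain = simplex4 →
      EqOn z4.integrand (fun t => 1 / (t 0 * t 1 * t 2 * (1 - t 3))) z4.domain →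
      KZ.of p - 2 • KZ.of z22 - KZ.of z4 ∈ KZ.relations)
    (hSh : ∀ p z22 z31 : KZ.IntegralRep 4, p.domain = prodCell →
      EqOn p.integrand (fun t => 1 / (t 0 * (1 - t 1) * t 2 * (1 - t 3))) p.domain →
      z22.domain = simplex4 →
      EqOn z22.integrand (fun t => 1 / (t 0 * (1 - t 1) * t 2 * (1 - t 3))) z22.domain →
      z31.domain = simplex4 →
      EqOn z31.integrand (fun t => 1 / (t 0 * t 1 * (1 - t 2) * (1 - t 3))) z31.domain →
      KZ.of p - 2 • KZ.of z22 - 4 • KZ.of z31 ∈ KZ.relations)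
    (hP : ∃ p : KZ.IntegralRep 4, p.domain = prodCell ∧
      EqOn p.integrand (fun t => 1 / (t 0 * (1 - t 1) * t 2 * (1 - t 3))) p.domain) :
    Summit.KontsevichZagierPeriods.KontsevichZagierPeriods.Theses.Grothendieck.GpcZeta4Eq4zeta31 := by
  sorry

end Summit.KontsevichZagierPeriods.KontsevichZagierPeriods.Cruxes.GpcZeta4Eq4zeta31.SketchIdeator1
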